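import Summits.CriticalPhenomena.PercolationContinuityZ3.Theorems.PercNearOneGluingNoHeavyQuantHubBlocksRowsStep
import HarnessLib

/-!
# QUANT lane R8, FAR on trees: the loose hub with SEVERAL root blocks — capped far-relay rows by peeling the blocks
# (gate coordinates; the vocabulary of `Quant.tree_relayCount_transfer` / `Quant.FarTreeRow`)

builds on p205010 (kernel theorem, internal audit signed; external expert review pending)

Support file (`--supports stmt-CriticalPhenomena-4575`), QUANT lane typer seat prim-quant-stmt (gen 11); step and base in
`…QuantHubBlocksRowsStep.lean`; tree / route-vocabulary wrappers in `…QuantFarTreeHubBlocks.lean`.  Continues `…QuantFarTreeHubBlock.lean`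
(gen 10: ONE root block) towards LEAD-NOTES-G6 N14 (4) ("loose hub + root blocks", several blocks; TLB-NOTES §9 [MTL]).
Theorems only; no definitions, no sorries, standard axioms.

**Setting.**  Gates `q` on `Fin n`; hub `h` with leaf relays `L`; root blocks `b ∈ K` of sizes `s b ≥ 1`; count
`R_K(ω) = Σ_{b ∈ K ∩ ω} s b + 1[h ∈ ω]·#(L ∩ ω)`.  Leaf floor `0 < u₀ ≤ 1`, `u₀ ≤ q ℓ`; block credit `κ ≤ u₀`, `κ ≤ q b`, regime `q b ≥ 1/2`;
`q h·u₀ ≤ κ`.  CAPPED MEAN `M_K = (κ/u₀)·Σ_{ℓ∈L} q ℓ + κ·Σ_{b∈K} s b`.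

* `Quant.hubBlocks_tailRows` / `Quant.hubBlocks_rows` — for all `k, a` with `2k + a(2−κ) < M_K`:
  `q h·u₀ ≤ κ·P(R_K ≥ k+1) + (1−κ)·P(R_K ≥ k+a+1)` (induction on `K`: `Quant.hubRows_base`, `Quant.cappedRows_step`).
* `Quant.hubBlocks_smallBall` — the row `(j, 0)`: **`2j < M_K ⟹ P(R_K ≤ j) ≤ 1 − q h·u₀`.**
  Two specialisations give the far-relay row itself (`Quant.FarRelayRow`) for "hub with leaves + any number of root blocks of a COMMON gate
  `g₀ ≥ 1/2`", all layers: (i) blocks least reliable (`g₀ ≤ q h·min q ℓ`): `κ = g₀`, `u₀ = g₀/q h`, `M_K = E R_K`, bound `1 − g₀`; (ii) a leaf least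
  reliable and `g₀ ≤ min q ℓ`: `κ = g₀`, `u₀ = min q ℓ`, `M_K ≥ E R_K`, bound `1 − q h·min q ℓ`.  For blocks of different gates the row is CAPPED
  (each block credited `κ·s b`); numerically the uncapped row holds (TLB-NOTES §9: 0 / 1 855; this seat 0 / 14 210 random + climbs).
[cite: KozmaNitzan2024, Conjecture 3 (p. 15)] (the gluing rows served); the family result is [this work].
-/

noncomputable section

namespace Summit.CriticalPhenomena.PercolationContinuityZ3.Theorems

namespace Quant

open Finset MeasureTheory
open Literature.Probability.LatticeModels
open Literature.Probability.Percolation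
open scoped Classical

/-! ### All rows, by induction on the set of blocks -/

section Assembly

variable {n : ℕ}

/-- Splitting off one block from the count: for `b ∉ K`,
`Σ_{x ∈ (K ∪ {b}) ∩ ω} s x + 1[h∈ω]·#(L∩ω) = 1[b∈ω]·s b + (Σ_{x ∈ K ∩ ω} s x + 1[h∈ω]·#(L∩ω))`. [folklore] -/
theorem hubBlocks_count_insert (h b : Fin n) (L K : Finset (Fin n)) (s : Fin n → ℕ) (hbK : b ∉ K)
    (ω : Set (Fin n)) :
    (∑ x ∈ (insert b K).filter (fun x => x ∈ ω), s x) + (if h ∈ ω then (L.filter fun x => x ∈ ω).card else 0) =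
      (if b ∈ ω then s b else 0) +
        ((∑ x ∈ K.filter (fun x => x ∈ ω), s x) + (if h ∈ ω then (L.filter fun x => x ∈ ω).card else 0)) := by
  by_cases hb : b ∈ ω
  · rw [Finset.filter_insert, if_pos hb, Finset.sum_insert (fun h' => hbK (Finset.mem_filter.1 h').1), if_pos hb]
    ring
  · rw [Finset.filter_insert, if_neg hb, if_neg hb, zero_add]

/-- The count over the blocks `K` and the hub star does not depend on a coordinate `b ∉ K ∪ {h} ∪ L`. [folklore] -/
theorem hubBlocks_count_indep (h b : Fin n) (L K : Finset (Fin n)) (s : Fin n → ℕ) (hbK : b ∉ K) (hbh : b ≠ h)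
    (hbL : b ∉ L) (ω : Set (Fin n)) :
    ((∑ x ∈ K.filter (fun x => x ∈ insert b ω), s x) +
        (if h ∈ insert b ω then (L.filter fun x => x ∈ insert b ω).card else 0) =
      (∑ x ∈ K.filter (fun x => x ∈ ω), s x) + (if h ∈ ω then (L.filter fun x => x ∈ ω).card else 0)) ∧
    ((∑ x ∈ K.filter (fun x => x ∈ ω \ {b}), s x) +
        (if h ∈ ω \ {b} then (L.filter fun x => x ∈ ω \ {b}).card else 0) =
      (∑ x ∈ K.filter (fun x => x ∈ ω), s x) + (if h ∈ ω then (L.filter fun x => x ∈ ω).card else 0)) := by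
  have hK1 : K.filter (fun x => x ∈ insert b ω) = K.filter (fun x => x ∈ ω) := by
    refine Finset.filter_congr fun x hx => ?_
    have hxb : x ≠ b := fun hxb => hbK (hxb ▸ hx)
    simp [Set.mem_insert_iff, hxb]
  have hL1 : L.filter (fun x => x ∈ insert b ω) = L.filter (fun x => x ∈ ω) := by
    refine Finset.filter_congr fun x hx => ?_
    have hxb : x ≠ b := fun hxb => hbL (hxb ▸ hx)
    simp [Set.mem_insert_iff, hxb]
  have hK0 : K.filter (fun x => x ∈ ω \ {b}) = K.filter (fun x => x ∈ ω) := by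
    refine Finset.filter_congr fun x hx => ?_
    have hxb : x ≠ b := fun hxb => hbK (hxb ▸ hx)
    simp [hxb]
  have hL0 : L.filter (fun x => x ∈ ω \ {b}) = L.filter (fun x => x ∈ ω) := by
    refine Finset.filter_congr fun x hx => ?_
    have hxb : x ≠ b := fun hxb => hbL (hxb ▸ hx)
    simp [hxb]
  have hh1 : (h ∈ insert b ω) ↔ h ∈ ω := by simp [Set.mem_insert_iff, hbh.symm]
  have hh0 : (h ∈ ω \ {b}) ↔ h ∈ ω := by simp [hbh.symm]
  refine ⟨?_, ?_⟩
  · rw [hK1, hL1]; simp only [hh1]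
  · rw [hK0, hL0]; simp only [hh0]

/-- **Capped rows for the loose hub with root blocks (tail form).**  Gates `q` on `Fin n`; hub `h` with leaves `L` (leaf floor
`0 < u₀ ≤ q ℓ`); blocks `b ∈ K` of sizes `s b ≥ 1` with credit floor `κ ≤ q b` and regime `q b ≥ 1/2`; `κ ≤ u₀` and `q h · u₀ ≤ κ`;
`h ∉ L ∪ K`, `L ∩ K = ∅`.  For the count `R_K(ω) = Σ_{b ∈ K ∩ ω} s b + 1[h ∈ ω]·#(L ∩ ω)` and every `k, a` with
`2k + a(2−κ) < (κ/u₀)·Σ_L q ℓ + κ·Σ_K s b` (capped mean): `q h·u₀ ≤ κ·P(R_K ≥ k+1) + (1−κ)·P(R_K ≥ k+a+1)`.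
Induction on `K`: `Quant.hubRows_base`, then `Quant.cappedRows_step` through `Quant.prodBernoulli_real_tail_insert_block`. [this work] -/
theorem hubBlocks_tailRows (q : Fin n → unitInterval) (h : Fin n) (L : Finset (Fin n)) (s : Fin n → ℕ) (u₀ κ : ℝ)
    (hu0 : 0 < u₀) (hu1 : u₀ ≤ 1) (hhL : h ∉ L) (huL : ∀ ℓ ∈ L, u₀ ≤ (q ℓ : ℝ)) (hκu : κ ≤ u₀)
    (hGκ : (q h : ℝ) * u₀ ≤ κ)
    (K : Finset (Fin n)) (hhK : h ∉ K) (hLK : Disjoint L K) (hκK : ∀ b ∈ K, κ ≤ (q b : ℝ))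
    (hhalf : ∀ b ∈ K, (1 / 2 : ℝ) ≤ q b) (hs : ∀ b ∈ K, 1 ≤ s b) (k a : ℕ)
    (hB : (2 * k : ℝ) + a * (2 - κ) < κ / u₀ * ∑ ℓ ∈ L, (q ℓ : ℝ) + κ * ∑ b ∈ K, (s b : ℝ)) :
    (q h : ℝ) * u₀ ≤
      κ * (prodBernoulli q).real {ω : Set (Fin n) | k + 1 ≤
        (∑ x ∈ K.filter (fun x => x ∈ ω), s x) + (if h ∈ ω then (L.filter fun x => x ∈ ω).card else 0)} +
      (1 - κ) * (prodBernoulli q).real {ω : Set (Fin n) | k + a + 1 ≤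
        (∑ x ∈ K.filter (fun x => x ∈ ω), s x) + (if h ∈ ω then (L.filter fun x => x ∈ ω).card else 0)} := by
  induction K using Finset.induction_on generalizing k a with
  | empty =>
    simp only [Finset.filter_empty, Finset.sum_empty, zero_add]
    rw [Finset.sum_empty, mul_zero, add_zero] at hB
    exact hubRows_base q h L hhL u₀ κ hu0 hu1 huL hκu k a hB
  | insert b K hbK ih =>
    have hbh : b ≠ h := fun hbh => hhK (hbh ▸ Finset.mem_insert_self b K)
    have hhK' : h ∉ K := fun hh => hhK (Finset.mem_insert_of_mem hh)
    have hbL : b ∉ L := fun hbL => Finset.disjoint_left.1 hLK hbL (Finset.mem_insert_self b K)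
    have hLK' : Disjoint L K := Disjoint.mono_right (Finset.subset_insert b K) hLK
    have hκK' : ∀ x ∈ K, κ ≤ (q x : ℝ) := fun x hx => hκK x (Finset.mem_insert_of_mem hx)
    have hhalf' : ∀ x ∈ K, (1 / 2 : ℝ) ≤ q x := fun x hx => hhalf x (Finset.mem_insert_of_mem hx)
    have hs' : ∀ x ∈ K, 1 ≤ s x := fun x hx => hs x (Finset.mem_insert_of_mem hx)
    set μ := prodBernoulli q with hμ
    set R : Set (Fin n) → ℕ := fun ω =>
      (∑ x ∈ K.filter (fun x => x ∈ ω), s x) + (if h ∈ ω then (L.filter fun x => x ∈ ω).card else 0) with hR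
    have hev : ∀ x : ℕ, {ω : Set (Fin n) | x ≤ (∑ y ∈ (insert b K).filter (fun y => y ∈ ω), s y) +
        (if h ∈ ω then (L.filter fun y => y ∈ ω).card else 0)} = {ω | x ≤ (if b ∈ ω then s b else 0) + R ω} := by
      intro x; ext ω
      simp only [Set.mem_setOf_eq, hubBlocks_count_insert h b L K s hbK ω, hR]
    have hR1 : ∀ ω, R (insert b ω) = R ω := fun ω => by
      simp only [hR]; convert (hubBlocks_count_indep h b L K s hbK hbh hbL ω).1
    have hR0 : ∀ ω, R (ω \ {b}) = R ω := fun ω => by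
      simp only [hR]; convert (hubBlocks_count_indep h b L K s hbK hbh hbL ω).2
    rw [hev (k + 1), hev (k + a + 1), prodBernoulli_real_tail_insert_block q b (s b) R hR1 hR0 (k + 1),
      prodBernoulli_real_tail_insert_block q b (s b) R hR1 hR0 (k + a + 1)]
    -- the tail of `R` and its rows (induction hypothesis)
    set T : ℕ → ℝ := fun x => μ.real {ω : Set (Fin n) | x ≤ R ω} with hT
    have hTanti : Antitone T := by
      intro x y hxy
      exact measureReal_mono (fun ω (hω : y ≤ R ω) => le_trans hxy hω) (measure_ne_top _ _)
    have hT0 : T 0 = 1 := by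
      have : {ω : Set (Fin n) | 0 ≤ R ω} = Set.univ := by ext ω; simp
      simp only [hT, this, probReal_univ]
    have hTnn : ∀ x, 0 ≤ T x := fun x => measureReal_nonneg
    set M : ℝ := κ / u₀ * ∑ ℓ ∈ L, (q ℓ : ℝ) + κ * ∑ x ∈ K, (s x : ℝ) with hM
    have hrows : ∀ k a : ℕ, (2 * k : ℝ) + a * (2 - κ) < M →
        (q h : ℝ) * u₀ ≤ κ * T (k + 1) + (1 - κ) * T (k + a + 1) :=
      fun k a hb => ih hhK' hLK' hκK' hhalf' hs' k a hb
    have hB' : (2 * k : ℝ) + a * (2 - κ) < M + κ * (s b : ℕ) := by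
      rw [Finset.sum_insert hbK] at hB
      rw [hM]; linarith
    exact cappedRows_step T hTanti hT0 hTnn ((q h : ℝ) * u₀) κ (q b) M (s b) hGκ
      (hκK b (Finset.mem_insert_self b K)) (hhalf b (Finset.mem_insert_self b K)) (q b).2.2
      (hs b (Finset.mem_insert_self b K)) hrows k a hB'

/-- **Capped rows (small-ball form).**  Under the hypotheses of `Quant.hubBlocks_tailRows`:
`κ · P(R_K ≤ k) + q h·u₀ ≤ κ + (1−κ) · P(R_K ≥ k+a+1)` whenever `2k + a(2−κ) < (κ/u₀)·Σ_L q ℓ + κ·Σ_K s b`. [this work] -/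
theorem hubBlocks_rows (q : Fin n → unitInterval) (h : Fin n) (L : Finset (Fin n)) (s : Fin n → ℕ) (u₀ κ : ℝ)
    (hu0 : 0 < u₀) (hu1 : u₀ ≤ 1) (hhL : h ∉ L) (huL : ∀ ℓ ∈ L, u₀ ≤ (q ℓ : ℝ)) (hκu : κ ≤ u₀)
    (hGκ : (q h : ℝ) * u₀ ≤ κ)
    (K : Finset (Fin n)) (hhK : h ∉ K) (hLK : Disjoint L K) (hκK : ∀ b ∈ K, κ ≤ (q b : ℝ))
    (hhalf : ∀ b ∈ K, (1 / 2 : ℝ) ≤ q b) (hs : ∀ b ∈ K, 1 ≤ s b) (k a : ℕ)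
    (hB : (2 * k : ℝ) + a * (2 - κ) < κ / u₀ * ∑ ℓ ∈ L, (q ℓ : ℝ) + κ * ∑ b ∈ K, (s b : ℝ)) :
    κ * (prodBernoulli q).real {ω : Set (Fin n) |
        (∑ x ∈ K.filter (fun x => x ∈ ω), s x) + (if h ∈ ω then (L.filter fun x => x ∈ ω).card else 0) ≤ k} +
      (q h : ℝ) * u₀ ≤
      κ + (1 - κ) * (prodBernoulli q).real {ω : Set (Fin n) | k + a + 1 ≤
        (∑ x ∈ K.filter (fun x => x ∈ ω), s x) + (if h ∈ ω then (L.filter fun x => x ∈ ω).card else 0)} := by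
  have hmeas : ∀ S : Set (Set (Fin n)), MeasurableSet S := fun S => MeasurableSet.of_discrete
  have hcompl : (prodBernoulli q).real {ω : Set (Fin n) |
      (∑ x ∈ K.filter (fun x => x ∈ ω), s x) + (if h ∈ ω then (L.filter fun x => x ∈ ω).card else 0) ≤ k} =
      1 - (prodBernoulli q).real {ω : Set (Fin n) | k + 1 ≤
        (∑ x ∈ K.filter (fun x => x ∈ ω), s x) + (if h ∈ ω then (L.filter fun x => x ∈ ω).card else 0)} := by
    rw [← probReal_compl_eq_one_sub (hmeas _)]
    congr 1
    ext ω
    simp only [Set.mem_setOf_eq, Set.mem_compl_iff, not_le]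
    omega
  rw [hcompl]
  have := hubBlocks_tailRows q h L s u₀ κ hu0 hu1 hhL huL hκu hGκ K hhK hLK hκK hhalf hs k a hB
  linarith

/-- **The capped far-relay row for the loose hub with root blocks.**  Gates `q` on `Fin n`; hub `h` with leaves `L` (leaf floor
`0 < u₀ ≤ q ℓ`); blocks `b ∈ K` of sizes `s b ≥ 1`, credit floor `κ ≤ q b`, regime `q b ≥ 1/2`; `κ ≤ u₀`, `q h · u₀ ≤ κ`.  At every
layer `j`: if `2j < (κ/u₀)·Σ_{ℓ∈L} q ℓ + κ·Σ_{b∈K} s b` (the CAPPED mean) then `P(R_K ≤ j) ≤ 1 − q h · u₀`.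
Two uses (`…QuantFarTreeHubBlocks.lean`): (i) blocks least reliable with common gate `g₀ = κ`, `u₀ = g₀ / q h`: the capped mean is the mean
`E R_K` and the bound is `1 − g₀` — the far-relay row; (ii) a leaf least reliable, `u₀ =` least leaf gate, `κ = g₀ ≤ u₀` the common block gate:
capped mean `≥ E R_K` and the bound is `1 − q h·u₀` — again the far-relay row. [this work] -/
theorem hubBlocks_smallBall (q : Fin n → unitInterval) (h : Fin n) (L : Finset (Fin n)) (s : Fin n → ℕ) (u₀ κ : ℝ)
    (hu0 : 0 < u₀) (hu1 : u₀ ≤ 1) (hhL : h ∉ L) (huL : ∀ ℓ ∈ L, u₀ ≤ (q ℓ : ℝ)) (hκu : κ ≤ u₀)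
    (hGκ : (q h : ℝ) * u₀ ≤ κ)
    (K : Finset (Fin n)) (hhK : h ∉ K) (hLK : Disjoint L K) (hκK : ∀ b ∈ K, κ ≤ (q b : ℝ))
    (hhalf : ∀ b ∈ K, (1 / 2 : ℝ) ≤ q b) (hs : ∀ b ∈ K, 1 ≤ s b) (j : ℕ)
    (hEN : (2 * j : ℝ) < κ / u₀ * ∑ ℓ ∈ L, (q ℓ : ℝ) + κ * ∑ b ∈ K, (s b : ℝ)) :
    (prodBernoulli q).real {ω : Set (Fin n) |
        (∑ x ∈ K.filter (fun x => x ∈ ω), s x) + (if h ∈ ω then (L.filter fun x => x ∈ ω).card else 0) ≤ j} ≤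
      1 - (q h : ℝ) * u₀ := by
  have hB : (2 * j : ℝ) + (0 : ℕ) * (2 - κ) < κ / u₀ * ∑ ℓ ∈ L, (q ℓ : ℝ) + κ * ∑ b ∈ K, (s b : ℝ) := by
    push_cast; linarith
  have hrow := hubBlocks_rows q h L s u₀ κ hu0 hu1 hhL huL hκu hGκ K hhK hLK hκK hhalf hs j 0 hB
  simp only [add_zero] at hrow
  have hmeas : ∀ S : Set (Set (Fin n)), MeasurableSet S := fun S => MeasurableSet.of_discrete
  have hcompl : (prodBernoulli q).real {ω : Set (Fin n) |
      (∑ x ∈ K.filter (fun x => x ∈ ω), s x) + (if h ∈ ω then (L.filter fun x => x ∈ ω).card else 0) ≤ j} =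
      1 - (prodBernoulli q).real {ω : Set (Fin n) | j + 1 ≤
        (∑ x ∈ K.filter (fun x => x ∈ ω), s x) + (if h ∈ ω then (L.filter fun x => x ∈ ω).card else 0)} := by
    rw [← probReal_compl_eq_one_sub (hmeas _)]
    congr 1
    ext ω
    simp only [Set.mem_setOf_eq, Set.mem_compl_iff, not_le]
    omega
  rw [hcompl] at hrow ⊢
  linarith

end Assembly

end Quant

end Summit.CriticalPhenomena.PercolationContinuityZ3.Theorems

end
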